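import Literature.IUT.HodgeTheaters.GlobalFrobenioidsCyclotomes
import HarnessLib

/-!
# [IUTchI] Example 5.1 (v) p. 128 — NON-VACUITY of the cyclotome-comparison interfaces
# `CyclotomeComparisonFamily` / `CyclotomeComparison` and of their uniqueness clauses (row «NV-L5/CyclotomeComparisonFamily»)

Mochizuki, *Inter-universal Teichmüller theory I*, kurims manuscript (May 2020), Example 5.1 (v) p. 128, second
display: "there exists a unique isomorphism of cyclotomes `μ^Θ_Ẑ(π₁(†𝒟^⊚)) ⥲ μ_Ẑ(†𝕄^⊛)` such that the resulting
isomorphism between direct limits of cohomology modules induces isomorphisms `𝕄^⊛(†𝒟^⊚) ⥲ †𝕄^⊛`,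
`𝕄^⊛_sol(†𝒟^⊚) ⥲ †𝕄^⊛_sol`, `𝕄^⊛_mod(†𝒟^⊚) ⥲ †𝕄^⊛_mod` … in a fashion that is compatible with the integral
submonoids `𝒪^▷_𝔭`", the uniqueness resting (p. 127) on "the elementary observation that, relative to the natural
inclusion `ℚ ↪ Ẑ ⊗ ℚ`, `ℚ_{>0} ∩ Ẑ^× = {1}`".  PROOF-ONLY companion (no `def`, no `instance`, no `structure`) of
`GlobalFrobenioidsCyclotomes.lean` (abc-iut-L5-t1 g2: the data record `CyclotomeComparisonFamily ι 𝔓`, its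
such-that clause `InducesCompatibleIsos`, the predicate `UniqueCyclotomeIsoFamily`, the restriction `component`
to the sibling record `CyclotomeComparison` / `UniqueCyclotomeIso` of `GlobalFrobenioidsKummer.lean`).
abc-iut-w5-d197's INHABITATION CENSUS L5 v1 lists `CyclotomeComparisonFamily` with ZERO producers, and the
sibling `CyclotomeComparison` has exactly one producer, `CyclotomeComparisonFamily.component` — so neither record
nor any of the three predicates had a kernel instance.  This file records, kernel-checked:

* §1 EXACT CRITERION — the interface is a FREE DATA RECORD (no law fields): it is inhabited over any index types
  from any data (`nonempty_of_data`, label `parameterRecord`), in every universe (`nonempty_degenerate`, label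
  `degenerate`: `PUnit` carriers — evidence for "the type is inhabited" only), and every sibling
  `CyclotomeComparison` extends to a family with prescribed integral submonoids whose every `component` is the
  given one (`exists_forall_component_eq`).
* §2 THE ONE-PRIME VALUATION TOY (label `valuationToy`; an honest finite shadow of print's mechanism, NOT the
  genuine ∞κ/κ-coric cyclotome family, which needs the Kummer map [TODO-merge abc-iut-L2-t3] and the
  [AbsTopIII] Thm 1.9 (d)(e) containers [abc-iut-L4-t1], absent from the tree): dictionary — Kummer container
  modulo units at ONE prime `𝔭` ↦ the value group `F_𝔭^×/𝒪^×_𝔭 ≅ ℤ` (here `Multiplicative ℤ`); `𝒪^▷_𝔭` ↦ the cone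
  `{n ≥ 0}`; the images of the GROUPS `𝕄^⊛ ⊇ 𝕄^⊛_sol ⊇ 𝕄^⊛_mod` ↦ all of `ℤ`; the cyclotome ↦ `Multiplicative ℤ`,
  whose automorphism group `{±1}` (the shadow of `Ẑ^× ∩ ℚ^× = {±1}`) acts on Kummer classes by multiplication.
  Kernel facts: the such-that clause is SATISFIABLE (`e = 1`); the LAYER clause alone does NOT pin `e` (inversion
  `−1` maps every group layer onto itself) while the INTEGRAL-SUBMONOID clause kills `−1` (`1 ↦ −1 ∉ 𝒪^▷`) — the toy
  form of "`ℚ_{>0} ∩ Ẑ^× = {1}`"; hence `UniqueCyclotomeIsoFamily` HOLDS for the toy with cones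
  (`exists_uniqueCyclotomeIsoFamily_valuationToy`) and FAILS for the toy without integral structure
  (`exists_not_uniqueCyclotomeIsoFamily_valuationToy`): the predicate is neither vacuous nor trivially true, and
  the integral clause of the printed display is load-bearing exactly as in print.
* §3 The sibling predicate `UniqueCyclotomeIso` (FACT-LIST F-2582, a schema over `CyclotomeComparison`) is
  likewise SATISFIABLE (`exists_uniqueCyclotomeIso_valuationToy`, cone layer) and REFUTABLE
  (`exists_not_uniqueCyclotomeIso_valuationToy`, group layer) — so its universal closure is not a fact and it is
  consumable AT NAMED INSTANCES ONLY; and the landed `UniqueCyclotomeIsoFamily.of_component` is INSTANTIATED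
  (`exists_uniqueCyclotomeIsoFamily_of_component_valuationToy`).

HONEST LABELS: `parameterRecord` / `degenerate` / `valuationToy` as above; nothing here is the genuine printed
object, nothing of [IUTchI] is asserted; a witness is consistency evidence only ("instantiated ≠ endorsed").
[claim: Mochizuki2012, status: disputed]
-/

namespace Literature.IUT.HodgeTheaters

open Multiplicative

universe w' w u

/-! ### §1 The interface is a free data record -/

namespace CyclotomeComparisonFamily

/-- **IUTchI:Ex5.1(v)** (kurims p.128) `parameterRecord`: over any index types `ι`, `𝔓`, ANY two cyclotomes, two
containers, matched families and induced-map assignment form a `CyclotomeComparisonFamily` with exactly these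
carriers (the record has no law fields). [claim: Mochizuki2012, status: disputed] -/
theorem nonempty_of_data {ι : Type w} {𝔓 : Type w'} (μ₁ μ₂ : Type u) [CommGroup μ₁] [CommGroup μ₂]
    (H₁ H₂ : Type u) (im₁ : ι → Set H₁) (im₂ : ι → Set H₂) (int₁ : 𝔓 → Set H₁) (int₂ : 𝔓 → Set H₂)
    (induced : (μ₁ ≃* μ₂) → H₁ → H₂) :
    ∃ C : CyclotomeComparisonFamily ι 𝔓, C.μ₁ = μ₁ ∧ C.μ₂ = μ₂ ∧ C.H₁ = H₁ ∧ C.H₂ = H₂ :=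
  ⟨{ μ₁ := μ₁, μ₂ := μ₂, H₁ := H₁, H₂ := H₂, im₁ := im₁, im₂ := im₂, int₁ := int₁, int₂ := int₂,
     induced := induced }, rfl, rfl, rfl, rfl⟩

/-- **IUTchI:Ex5.1(v)** (kurims p.128) `degenerate` (TOY label, evidence for "the type is inhabited" only): in
every universe and over any index types the record is inhabited by `PUnit` carriers.
[claim: Mochizuki2012, status: disputed] -/
theorem nonempty_degenerate (ι : Type w) (𝔓 : Type w') :
    Nonempty (CyclotomeComparisonFamily.{w', w, u} ι 𝔓) :=
  ⟨{ μ₁ := PUnit.{u + 1}, μ₂ := PUnit.{u + 1}, H₁ := PUnit.{u + 1}, H₂ := PUnit.{u + 1},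
     im₁ := fun _ => Set.univ, im₂ := fun _ => Set.univ, int₁ := fun _ => Set.univ,
     int₂ := fun _ => Set.univ, induced := fun _ => id }⟩

/-- **IUTchI:Ex5.1(v)** (kurims p.128) `parameterRecord`: every sibling one-layer comparison `C₀ :
CyclotomeComparison` (GlobalFrobenioidsKummer.lean) extends (here with the trivial integral structure `𝒪^▷ :=`
everything) to a family ALL of whose layers `component i` are `C₀` (constant family) — the converse of the landed
restriction `CyclotomeComparisonFamily.component`. [claim: Mochizuki2012, status: disputed] -/
theorem exists_forall_component_eq (C₀ : CyclotomeComparison.{u}) (ι : Type w) (𝔓 : Type w') :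
    ∃ C : CyclotomeComparisonFamily.{w', w, u} ι 𝔓, ∀ i, C.component i = C₀ :=
  ⟨{ μ₁ := C₀.μ₁, μ₂ := C₀.μ₂, H₁ := C₀.H₁, H₂ := C₀.H₂, im₁ := fun _ => C₀.im₁, im₂ := fun _ => C₀.im₂,
     int₁ := fun _ => Set.univ, int₂ := fun _ => Set.univ, induced := C₀.induced }, fun _ => rfl⟩

/-- **IUTchI:Ex5.1(v)** (kurims p.128) Hence the sibling record is inhabited as soon as the family record is
(through `component`), and conversely — the two zero/one-producer rows of the census stand or fall together.
[claim: Mochizuki2012, status: disputed] -/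
theorem nonempty_iff_nonempty_component (ι : Type w) (𝔓 : Type w') [Nonempty ι] :
    Nonempty (CyclotomeComparisonFamily.{w', w, u} ι 𝔓) ↔ Nonempty CyclotomeComparison.{u} :=
  ⟨fun ⟨C⟩ => ⟨C.component (Classical.arbitrary ι)⟩, fun ⟨C₀⟩ =>
    let ⟨C, _⟩ := exists_forall_component_eq C₀ ι 𝔓
    ⟨C⟩⟩

end CyclotomeComparisonFamily

/-! ### §2 The one-prime valuation toy: automorphisms of `Multiplicative ℤ` versus the cone `{n ≥ 0}` -/

section ValuationToy

/-- An automorphism of the toy cyclotome `Multiplicative ℤ` is multiplication by the integer `a := e(1)`.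
[claim: Mochizuki2012, status: disputed] -/
private theorem mulEquiv_int_apply (e : Multiplicative ℤ ≃* Multiplicative ℤ) (n : ℤ) :
    e (ofAdd n) = ofAdd (n * toAdd (e (ofAdd 1))) := by
  have h1 : (ofAdd n : Multiplicative ℤ) = ofAdd (1 : ℤ) ^ n := by
    rw [← ofAdd_zsmul, zsmul_eq_mul, Int.cast_id, mul_one]
  have h2 : e (ofAdd 1) = ofAdd (toAdd (e (ofAdd 1))) := (ofAdd_toAdd _).symm
  rw [h1, map_zpow, h2, ← ofAdd_zsmul, zsmul_eq_mul, Int.cast_id, toAdd_ofAdd]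

/-- … and `a = e(1)` is a unit of `ℤ`, i.e. `a = 1 ∨ a = −1` (the toy shadow of `Aut(Ẑ) = Ẑ^×`).
[claim: Mochizuki2012, status: disputed] -/
private theorem mulEquiv_int_gen (e : Multiplicative ℤ ≃* Multiplicative ℤ) :
    toAdd (e (ofAdd 1)) = 1 ∨ toAdd (e (ofAdd 1)) = -1 := by
  have h : e (ofAdd (toAdd (e.symm (ofAdd 1)))) = ofAdd 1 := by
    rw [ofAdd_toAdd, MulEquiv.apply_symm_apply]
  rw [mulEquiv_int_apply] at h
  have h' : toAdd (e.symm (ofAdd 1)) * toAdd (e (ofAdd 1)) = 1 := ofAdd.injective h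
  rw [mul_comm] at h'
  exact Int.eq_one_or_neg_one_of_mul_eq_one h'

/-- THE TOY FORM OF "`ℚ_{>0} ∩ Ẑ^× = {1}`": an automorphism of the toy cyclotome that maps the integral cone
`{n ≥ 0}` (`𝒪^▷_𝔭` modulo units) into itself is the identity. [claim: Mochizuki2012, status: disputed] -/
private theorem mulEquiv_int_eq_refl_of_mapsTo (e : Multiplicative ℤ ≃* Multiplicative ℤ)
    (h : Set.MapsTo e {x : Multiplicative ℤ | 0 ≤ toAdd x} {x | 0 ≤ toAdd x}) :
    e = MulEquiv.refl _ := by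
  have h0 : (0 : ℤ) ≤ toAdd (e (ofAdd 1)) := h (show (0 : ℤ) ≤ toAdd (ofAdd (1 : ℤ)) by simp)
  have h1 : toAdd (e (ofAdd 1)) = 1 := by
    rcases mulEquiv_int_gen e with h | h
    · exact h
    · omega
  ext x
  have hx := mulEquiv_int_apply e (toAdd x)
  rw [ofAdd_toAdd, h1, mul_one, ofAdd_toAdd] at hx
  rw [hx, MulEquiv.refl_apply]

/-- Inversion (`n ↦ −n`, the automorphism `−1`) is NOT the identity of the toy cyclotome.
[claim: Mochizuki2012, status: disputed] -/
private theorem mulEquiv_inv_ne_refl : MulEquiv.inv (Multiplicative ℤ) ≠ MulEquiv.refl _ := by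
  intro h
  have h1 := MulEquiv.congr_fun h (ofAdd (1 : ℤ))
  rw [MulEquiv.inv_apply, MulEquiv.refl_apply, ← ofAdd_neg] at h1
  have h2 : (-1 : ℤ) = 1 := ofAdd.injective h1
  omega

/-- Inversion does NOT map the cone `{n ≥ 0}` into itself (`1 ↦ −1`). [claim: Mochizuki2012, status: disputed] -/
private theorem not_mapsTo_inv_cone :
    ¬ Set.MapsTo (MulEquiv.inv (Multiplicative ℤ)) {x : Multiplicative ℤ | 0 ≤ toAdd x} {x | 0 ≤ toAdd x} := by
  intro h
  have h1 : (0 : ℤ) ≤ toAdd ((MulEquiv.inv (Multiplicative ℤ)) (ofAdd (1 : ℤ))) :=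
    h (show (0 : ℤ) ≤ toAdd (ofAdd (1 : ℤ)) by simp)
  rw [MulEquiv.inv_apply, ← ofAdd_neg, toAdd_ofAdd] at h1
  omega

/-- Every automorphism of the toy cyclotome maps the whole container (a GROUP layer: `𝕄^⊛`, `𝕄^⊛_sol`, `𝕄^⊛_mod`
are groups) bijectively onto itself. [claim: Mochizuki2012, status: disputed] -/
private theorem mulEquiv_bijOn_univ (e : Multiplicative ℤ ≃* Multiplicative ℤ) :
    Set.BijOn e (Set.univ : Set (Multiplicative ℤ)) Set.univ :=
  Set.bijOn_univ.2 e.bijective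

/-- **IUTchI:Ex5.1(v)** (kurims p.128) `valuationToy`, the family WITH integral structure (`ι = AstLayer`, one prime;
cyclotome and container `Multiplicative ℤ`, layers = the whole group, `𝒪^▷_𝔭` = the cone `{n ≥ 0}`, induced map =
the automorphism acting by multiplication): (a) the cyclotome has two distinct automorphisms (content: `±1`);
(b) the such-that clause `InducesCompatibleIsos` is SATISFIABLE (`e = 1`); (c) the LAYER clause alone does not
pin the isomorphism — some `e` maps every layer onto itself yet violates the integral clause (`e = −1`:
`1 ↦ −1 ∉ 𝒪^▷_𝔭`); (d) `UniqueCyclotomeIsoFamily` HOLDS: compatibility with `𝒪^▷_𝔭` forces `e = 1` — the toy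
form of print's "`ℚ_{>0} ∩ Ẑ^× = {1}`". [claim: Mochizuki2012, status: disputed] -/
theorem exists_uniqueCyclotomeIsoFamily_valuationToy :
    ∃ C : CyclotomeComparisonFamily.{0, 0, 0} AstLayer PUnit.{1},
      (∃ e e' : C.μ₁ ≃* C.μ₂, e ≠ e') ∧
      (∃ e : C.μ₁ ≃* C.μ₂, C.InducesCompatibleIsos e) ∧
      (∃ e : C.μ₁ ≃* C.μ₂, (∀ i, Set.BijOn (C.induced e) (C.im₁ i) (C.im₂ i)) ∧ ¬ C.InducesCompatibleIsos e) ∧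
      UniqueCyclotomeIsoFamily C := by
  refine ⟨{ μ₁ := Multiplicative ℤ, μ₂ := Multiplicative ℤ, H₁ := Multiplicative ℤ, H₂ := Multiplicative ℤ,
            im₁ := fun _ => Set.univ, im₂ := fun _ => Set.univ,
            int₁ := fun _ => {x | 0 ≤ toAdd x}, int₂ := fun _ => {x | 0 ≤ toAdd x},
            induced := fun e => e }, ?_, ?_, ?_, ?_⟩
  · exact ⟨MulEquiv.inv _, MulEquiv.refl _, mulEquiv_inv_ne_refl⟩
  · exact ⟨MulEquiv.refl _, fun _ => Set.bijOn_id _, fun _ => Set.bijOn_id _⟩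
  · refine ⟨MulEquiv.inv _, fun _ => mulEquiv_bijOn_univ _, fun h => ?_⟩
    exact not_mapsTo_inv_cone (h.2 PUnit.unit).mapsTo
  · refine ⟨⟨MulEquiv.refl _, ⟨fun _ => Set.bijOn_id _, fun _ => Set.bijOn_id _⟩, fun e he => ?_⟩⟩
    exact mulEquiv_int_eq_refl_of_mapsTo e (he.2 PUnit.unit).mapsTo

/-- **IUTchI:Ex5.1(v)** (kurims p.128) `valuationToy`, the family WITHOUT integral structure (`𝒪^▷_𝔭` replaced by
the whole group): the such-that clause holds for BOTH automorphisms `±1`, so `UniqueCyclotomeIsoFamily` FAILS —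
the predicate is not trivially true, and the integral-submonoid clause of the printed display is load-bearing.
[claim: Mochizuki2012, status: disputed] -/
theorem exists_not_uniqueCyclotomeIsoFamily_valuationToy :
    ∃ C : CyclotomeComparisonFamily.{0, 0, 0} AstLayer PUnit.{1},
      (∃ e : C.μ₁ ≃* C.μ₂, C.InducesCompatibleIsos e) ∧ ¬ UniqueCyclotomeIsoFamily C := by
  refine ⟨{ μ₁ := Multiplicative ℤ, μ₂ := Multiplicative ℤ, H₁ := Multiplicative ℤ, H₂ := Multiplicative ℤ,
            im₁ := fun _ => Set.univ, im₂ := fun _ => Set.univ,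
            int₁ := fun _ => Set.univ, int₂ := fun _ => Set.univ, induced := fun e => e }, ?_, ?_⟩
  · exact ⟨MulEquiv.refl _, fun _ => Set.bijOn_id _, fun _ => Set.bijOn_id _⟩
  · rintro ⟨e₀, -, huniq⟩
    have h1 : MulEquiv.inv (Multiplicative ℤ) = e₀ := huniq _ ⟨fun _ => mulEquiv_bijOn_univ _, fun _ => mulEquiv_bijOn_univ _⟩
    have h2 : MulEquiv.refl (Multiplicative ℤ) = e₀ := huniq _ ⟨fun _ => mulEquiv_bijOn_univ _, fun _ => mulEquiv_bijOn_univ _⟩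
    exact mulEquiv_inv_ne_refl (h1.trans h2.symm)

/-! ### §3 The sibling predicate `UniqueCyclotomeIso` and the landed `of_component` -/

/-- **IUTchI:Ex5.1(v)** (kurims p.128) `valuationToy`: the sibling schema `UniqueCyclotomeIso` (FACT-LIST F-2582)
is SATISFIABLE — for the one-layer comparison whose layer is the integral cone (a MONOID that is not a group, as
print's pseudo-monoid `𝕄^⊛_∞κ(†𝒟^⊚)` of rational functions), the only compatible automorphism is `1`, while
the cyclotome does have the second automorphism `−1`. [claim: Mochizuki2012, status: disputed] -/
theorem exists_uniqueCyclotomeIso_valuationToy :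
    ∃ C₀ : CyclotomeComparison.{0}, (∃ e e' : C₀.μ₁ ≃* C₀.μ₂, e ≠ e') ∧ UniqueCyclotomeIso C₀ := by
  refine ⟨{ μ₁ := Multiplicative ℤ, μ₂ := Multiplicative ℤ, H₁ := Multiplicative ℤ, H₂ := Multiplicative ℤ,
            im₁ := {x | 0 ≤ toAdd x}, im₂ := {x | 0 ≤ toAdd x}, induced := fun e => e }, ?_, ?_⟩
  · exact ⟨MulEquiv.inv _, MulEquiv.refl _, mulEquiv_inv_ne_refl⟩
  · exact ⟨⟨MulEquiv.refl _, Set.bijOn_id _, fun e he => mulEquiv_int_eq_refl_of_mapsTo e he.mapsTo⟩⟩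

/-- **IUTchI:Ex5.1(v)** (kurims p.128) `valuationToy`: … and REFUTABLE — for the one-layer comparison whose layer
is the whole GROUP, both `±1` are compatible; so the universal closure of `UniqueCyclotomeIso` is not a fact
(consumable at named instances only). [claim: Mochizuki2012, status: disputed] -/
theorem exists_not_uniqueCyclotomeIso_valuationToy :
    ∃ C₀ : CyclotomeComparison.{0}, (∃ e : C₀.μ₁ ≃* C₀.μ₂, Set.BijOn (C₀.induced e) C₀.im₁ C₀.im₂) ∧
      ¬ UniqueCyclotomeIso C₀ := by
  refine ⟨{ μ₁ := Multiplicative ℤ, μ₂ := Multiplicative ℤ, H₁ := Multiplicative ℤ, H₂ := Multiplicative ℤ,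
            im₁ := Set.univ, im₂ := Set.univ, induced := fun e => e }, ⟨MulEquiv.refl _, mulEquiv_bijOn_univ _⟩, ?_⟩
  rintro ⟨e₀, -, huniq⟩
  exact mulEquiv_inv_ne_refl ((huniq _ (mulEquiv_bijOn_univ _)).trans (huniq _ (mulEquiv_bijOn_univ _)).symm)

/-- **IUTchI:Ex5.1(v)** (kurims p.128) `valuationToy`: the landed reduction
`UniqueCyclotomeIsoFamily.of_component` (uniqueness at ONE layer + existence for the whole clause ⇒ the family
statement) is INSTANTIATED — for the family all of whose layers and integral submonoids are the cone, its two
hypotheses hold and it yields `UniqueCyclotomeIsoFamily`. [claim: Mochizuki2012, status: disputed] -/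
theorem exists_uniqueCyclotomeIsoFamily_of_component_valuationToy :
    ∃ C : CyclotomeComparisonFamily.{0, 0, 0} AstLayer PUnit.{1},
      UniqueCyclotomeIso (C.component AstLayer.ast) ∧ (∃ e, C.InducesCompatibleIsos e) ∧
        UniqueCyclotomeIsoFamily C := by
  let C : CyclotomeComparisonFamily.{0, 0, 0} AstLayer PUnit.{1} :=
    { μ₁ := Multiplicative ℤ, μ₂ := Multiplicative ℤ, H₁ := Multiplicative ℤ, H₂ := Multiplicative ℤ,
      im₁ := fun _ => {x | 0 ≤ toAdd x}, im₂ := fun _ => {x | 0 ≤ toAdd x},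
      int₁ := fun _ => {x | 0 ≤ toAdd x}, int₂ := fun _ => {x | 0 ≤ toAdd x}, induced := fun e => e }
  have huniq : UniqueCyclotomeIso (C.component AstLayer.ast) :=
    ⟨⟨MulEquiv.refl _, Set.bijOn_id _, fun e he => mulEquiv_int_eq_refl_of_mapsTo e he.mapsTo⟩⟩
  have hex : ∃ e, C.InducesCompatibleIsos e :=
    ⟨MulEquiv.refl _, fun _ => Set.bijOn_id _, fun _ => Set.bijOn_id _⟩
  exact ⟨C, huniq, hex, UniqueCyclotomeIsoFamily.of_component C AstLayer.ast huniq hex⟩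

end ValuationToy

end Literature.IUT.HodgeTheaters
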